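import Literature.Probability.LatticeModels.LatticeGreenFunction
import Literature.Probability.LatticeModels.IsingThermodynamics
import HarnessLib

/-!
# Definitions for line `SketchIdeator1` (planar-source Källén–Lehmann mixture) of the crux
# `SubharmonicOffOrigin` (stmt-CriticalPhenomena-1341, route PerfectScreening)

Objects posited by the line (lead prover-line-stmt-CriticalPhenomena-1341-a1-0), no theorems of content:

* `massiveGreen s x` — the **massive lattice Green function** (lattice Yukawa potential, resolvent kernel
  of the graph Laplacian) of `ℤ^d`, `(s − Δ)⁻¹ δ₀ (x) = ∫_{[-π,π]^d} cos (p·x) / (s + 2ε(p)) dp/(2π)^d`,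
  `ε(p) = ∑ᵢ (1 − cos pᵢ)` the tree's `dispersion`, in the normalisation of the tree's `latticeGreen`
  (`massiveGreen 0 = latticeGreen / 2 = G₀`, `massiveGreen_zero`);
* `planeSite y` — the coordinate plane `{x 0 = 0} ≅ ℤ²` inside `ℤ³`;
* `PlanarSourceMixture` — the line's TRANSFER TARGET `C⁺`: the critical two-point function of `ℤ³` is a
  positive superposition of massive lattice Green functions whose sources lie on the plane `{x 0 = 0}`,
  with the integrability / summability bookkeeping that makes the seven-point Laplacian stencil commute
  with the superposition.  Spectral meaning (reflection-positivity transfer-matrix calculus in direction 0,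
  `Ĝ(p₀,k) = ∫ A(k,ds)/(s + p̂₀² + k̂²)`): (i) the masses are nonnegative = the lattice spectral
  condition `E ≥ arccosh (1 + k̂²/2)`, and (ii) `k ↦ A(k, ds)` is positive-definite on `𝕋²` for every
  mass window (`α_y(ds)` are its Fourier coefficients).

The line: `PlanarSourceMixture → SubharmonicOffOrigin` (massive Poisson identity `Δ G_s = s G_s − δ₀`,
positivity `G_s ≥ 0`, cubic symmetry `twoPointPlus_perm_invariant_holds`), stubs registered on the item.
-/

noncomputable section

open MeasureTheory Real
open Literature.Probability.LatticeModels

namespace Summit.CriticalPhenomena.Ising3DConformalLimit.Theorems.PerfectScreening.Psk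

variable {d : ℕ}

/-- The **massive lattice Green function** of `ℤ^d` with mass parameter `s`:
`massiveGreen s x = ∫_{[-π,π]^d} cos (p·x) / (s + 2ε(p)) dp / (2π)^d`, `ε(p) = ∑ᵢ (1 − cos pᵢ)`
(so `s + 2ε(p)` is the Fourier symbol of `s − Δ`, `Δ` the graph Laplacian of `ℤ^d`).  For `s > 0` the
integrand is bounded and continuous, and `massiveGreen s = (s − Δ)⁻¹ δ₀`, the Green function of simple random
walk killed at rate `s/(2d + s)` per step (up to the factor `1/(2d+s)`); for `s = 0` it is `latticeGreen / 2`,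
i.e. the Green function `G₀` of the graph Laplacian (`d ≥ 3`; junk value `0` for `d ≤ 2`, as for
`latticeGreen`); for `s < 0` the value is whatever the Bochner integral returns (junk, never used).
(Lawler–Limic 2010, §4.2–4.3 (Green functions with killing); Glimm–Jaffe 1987, §9.5 (lattice
covariance `(−Δ_δ + m²)⁻¹`).) -/
def massiveGreen (s : ℝ) (x : Site d) : ℝ :=
  (∫ p in brillouin d, Real.cos (∑ i, p i * (x i : ℝ)) / (s + 2 * dispersion p)) / ((2 * π) ^ d)

/-- At `s = 0` the massive Green function is the tree's `latticeGreen / 2` (the Green function `G₀` of the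
graph Laplacian, cf. `latticeLaplacianZd_half_latticeGreen`), in every dimension (both sides are the junk
value `0` for `d ≤ 2`). -/
theorem massiveGreen_zero : ∀ {d : ℕ} (x : Site d), massiveGreen 0 x = latticeGreen x / 2 := by
  intro d x
  unfold massiveGreen latticeGreen
  have h : ∀ p : Fin d → ℝ, Real.cos (∑ i, p i * (x i : ℝ)) / (0 + 2 * dispersion p)
      = (1 / 2 : ℝ) * (Real.cos (∑ i, p i * (x i : ℝ)) / dispersion p) := by
    intro p; rw [zero_add]; ring
  simp_rw [h, integral_const_mul]
  ring

/-- The coordinate plane `{x 0 = 0} ≅ ℤ²` inside `ℤ³`: `planeSite y = (0, y 0, y 1)`. -/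
def planeSite (y : Fin 2 → ℤ) : Site 3 := Fin.cons 0 y

/-- `planeSite y` lies on the plane `{x 0 = 0}`. -/
@[simp] theorem planeSite_zero (y : Fin 2 → ℤ) : planeSite y 0 = 0 := rfl

/-- **PLANAR-SOURCE KÄLLÉN–LEHMANN MIXTURE** (transfer target of line `SketchIdeator1` of the crux
`SubharmonicOffOrigin`): there are finite measures `α_y` (`y ∈ ℤ²`) carried by `[0, ∞)` such that
`G(x) = ∑_{y ∈ ℤ²} ∫ massiveGreen s (x − (0,y)) dα_y(s)` for every `x ∈ ℤ³`, `G = criticalTwoPoint 3`, with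
every `s ↦ massiveGreen s (x − (0,y))` `α_y`-integrable and the family of integrals summable in `y` (so that
finite stencils commute with the superposition).  This is a CONJECTURE-shaped Prop (the line's crux-strength
stub asserts it); nothing in print proves or refutes it. -/
def PlanarSourceMixture : Prop :=
  ∃ α : (Fin 2 → ℤ) → Measure ℝ,
    (∀ y, IsFiniteMeasure (α y)) ∧ (∀ y, α y (Set.Iio 0) = 0) ∧
    (∀ (y : Fin 2 → ℤ) (x : Site 3), Integrable (fun s => massiveGreen s (x - planeSite y)) (α y)) ∧
    (∀ x : Site 3, Summable fun y => ∫ s, massiveGreen s (x - planeSite y) ∂(α y)) ∧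
    ∀ x : Site 3, criticalTwoPoint 3 x = ∑' y, ∫ s, massiveGreen s (x - planeSite y) ∂(α y)

end Summit.CriticalPhenomena.Ising3DConformalLimit.Theorems.PerfectScreening.Psk

end
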